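import Mathlib
import Summits.SmoothPoincare4.SmoothPoincare4.Theorems.SoloInformedBinaryIcosahedral

/-!
# The slope-`17` surgery group of `P(-2,3,7)` maps onto `ℤ/17 × SL(2,𝔽₅)`, and the slope-`23` surgery group of `P(-2,3,9)` onto `ℤ/23 × SL(2,𝔽₅)`

Input (L2) of the solo programme `solo-SmoothPoincare4-informed` (paper Part I, §4.2): the two Dehn
surgeries whose fundamental groups carry the binary icosahedral quotients used by the programme's
`P(-2,3,7)` / `P(-2,3,9)` certificates.

For the pretzel knot `P(-2,3,7)` we write down the WIRTINGER PRESENTATION of its standard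
12-crossing diagram — one generator per arc, one relator `xᵢ⁻¹ xⱼ xᵢ xₖ⁻¹` per crossing
(`crossings237`, computed from the diagram by `work/s17/pretzel_wirtinger.py`; arc `9` is the
reference meridian `μ`, and `lam237` is the preferred longitude read along the knot from arc `9`,
writhe-corrected by `μ⁻¹²`) — and add the surgery relator `μ¹⁷ λ`.  The resulting presented group
`G17` is, granting the (standard, unformalised) facts that the Wirtinger presentation presents the
knot group and that `(μ, λ)` is the peripheral pair, `π₁` of the slope-`17` surgery on `P(-2,3,7)`.
Likewise `G23` for the 14-crossing diagram of `P(-2,3,9)` and slope `23`.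

KERNEL-CHECKED HERE (no `native_decide`; matrix identities by `decide`):
* `ρ17 : G17 →* ℤ/17 × SL(2,𝔽₅)` is a well-defined SURJECTIVE homomorphism sending every arc to
  `(1, Mᵢ)` with `Mᵢ` of order `10` (`ρ17_surjective`); hence `G17` is non-abelian, not cyclic
  (`not_isCyclic_G17` — so, granting the presentation, `S³₁₇(P(-2,3,7))` is not a lens space), and
  either infinite or of order `≥ 2040` (`card_K17`, `le_card_G17`);
* the same for `ρ23 : G23 →* ℤ/23 × SL(2,𝔽₅)` (arcs ↦ `(1, Mᵢ)` with `Mᵢ` of order `6`), `2760 ≤ |G23|`.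
* `bijective_ρ17_of_card_le` / `bijective_ρ23_of_card_le`: the isomorphism follows from the upper
  bounds `|G17| ≤ 2040`, `|G23| ≤ 2760`.

NOT KERNEL-CHECKED: those upper bounds.  They hold — proof-logging Todd–Coxeter enumerations of the
Tietze-reduced 3-generator presentations over `H = ⟨μ⟩` complete (for `G17`: index `12` and the logged
`H`-relations give `μ¹⁷⁰ = 1`, so `|G17| ≤ 2040`; for `G23`: index `20`, `μ¹³⁸ = 1`, `|G23| ≤ 2760`) —
but the logged proofs are large: `144 710` one-line inferences over `40 518` auxiliary cosets for `G17`
and `≈ 1.2·10⁶` inferences for `G23`, in the format of `SoloInformedCosetEnumeration` (for `G17` that is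
≈ 400 files of the size of `SoloInformedBinaryIcosahedralOrderCert1`).  They are therefore shipped as
machine-readable certificates (`work/s110/certs/pretzel_m2_3_7_slope17.json`, `…_m2_3_9_slope23.json` in the
programme's HOME) with an independent 200-line checker (`work/s110/certio.py check`) that replays exactly the
inference rules of `SoloInformedCosetEnumeration`, instead of being replayed in the kernel.  The in-kernel
replay of the same format is demonstrated on `⟨2,3,5⟩` (`SoloInformedBinaryIcosahedralOrder`:
`|⟨x,y,z ∣ x²=y³=z⁵=xyz⟩| = 120`, 98 inferences).
-/

namespace Summit.SmoothPoincare4.SmoothPoincare4.Theorems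
namespace PretzelSurgery

open MatrixGroups BinaryIcosahedral

/-! ### Wirtinger relators and a generation lemma for `A × SL(2,𝔽₅)` -/

/-- The Wirtinger relator of a crossing `(i, j, k)`: `xᵢ⁻¹ xⱼ xᵢ xₖ⁻¹` (arc `k` is arc `j` conjugated
past the over-arc `i`). -/
def wrel {n : ℕ} (t : Fin n × Fin n × Fin n) : FreeGroup (Fin n) :=
  (FreeGroup.of t.1)⁻¹ * FreeGroup.of t.2.1 * FreeGroup.of t.1 * (FreeGroup.of t.2.2)⁻¹

/-- Image of a Wirtinger relator under `FreeGroup.lift`. -/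
theorem lift_wrel {n : ℕ} {K : Type*} [Group K] (f : Fin n → K) (t : Fin n × Fin n × Fin n) :
    FreeGroup.lift f (wrel t) = (f t.1)⁻¹ * f t.2.1 * f t.1 * (f t.2.2)⁻¹ := by
  simp [wrel]

/-- A subgroup of `A × SL(2,𝔽₅)` containing `A × 1`, `(1, x)` and `(1, y)` is everything
(`x, y` generate `SL(2,𝔽₅)`, `BinaryIcosahedral.eq_top_of_mem`). -/
theorem prod_eq_top {A : Type*} [Group A] {R : Subgroup (A × SL(2, ZMod 5))}
    (hA : ∀ a : A, ((a, 1) : A × SL(2, ZMod 5)) ∈ R) (hx : ((1, x) : A × SL(2, ZMod 5)) ∈ R)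
    (hy : ((1, y) : A × SL(2, ZMod 5)) ∈ R) : R = ⊤ := by
  have hB : R.comap (MonoidHom.inr A (SL(2, ZMod 5))) = ⊤ :=
    eq_top_of_mem (by simpa using hx) (by simpa using hy)
  rw [eq_top_iff]
  rintro ⟨a, b⟩ -
  have hb : ((1, b) : A × SL(2, ZMod 5)) ∈ R := by
    have : b ∈ R.comap (MonoidHom.inr A (SL(2, ZMod 5))) := hB ▸ Subgroup.mem_top b
    simpa using this
  simpa using R.mul_mem (hA a) hb

/-! ### `P(-2,3,7)`, slope `17` -/

/-- The twelve crossings `(i, j, k)` of the standard diagram of `P(-2,3,7)` (arcs `0, …, 11`). -/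
def crossings237 : List (Fin 12 × Fin 12 × Fin 12) :=
  [(0, 9, 7), (7, 10, 0), (7, 11, 6), (6, 7, 5), (5, 6, 4), (4, 5, 3), (3, 4, 2), (2, 3, 8), (8, 2, 9),
    (0, 8, 1), (1, 0, 11), (11, 1, 10)]

/-- The reference meridian: arc `9`. -/
def mu237 : FreeGroup (Fin 12) := FreeGroup.of 9

/-- The preferred longitude read from arc `9` (under-passed arcs in order, writhe correction `μ⁻¹²`). -/
def lam237 : FreeGroup (Fin 12) :=
  FreeGroup.of 0 * FreeGroup.of 6 * FreeGroup.of 4 * FreeGroup.of 2 * FreeGroup.of 0 * FreeGroup.of 11 *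
    FreeGroup.of 7 * FreeGroup.of 1 * FreeGroup.of 7 * FreeGroup.of 5 * FreeGroup.of 3 * FreeGroup.of 8 *
    mu237 ^ (-12 : ℤ)

/-- Relators of the slope-`17` surgery group: the Wirtinger relators and `μ¹⁷ λ`. -/
def rels17 : Set (FreeGroup (Fin 12)) := {r | r = mu237 ^ (17 : ℕ) * lam237 ∨ r ∈ crossings237.map wrel}

/-- `G17 = ⟨x₀, …, x₁₁ ∣ Wirtinger relators of P(-2,3,7), μ¹⁷ λ⟩`. -/
abbrev G17 : Type := PresentedGroup rels17

/-- The target `ℤ/17 × SL(2,𝔽₅)`. -/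
abbrev K17 : Type := Multiplicative (ZMod 17) × SL(2, ZMod 5)

/-- Images of the arcs in `SL(2,𝔽₅)` (all of order `10`; found by exhaustive search, `work/s110/quot`). -/
def M17 : Fin 12 → SL(2, ZMod 5) :=
  ![sl 0 1 4 3, sl 2 1 1 1, sl 0 4 1 3, sl 4 0 1 4, sl 4 4 0 4, sl 0 4 1 3, sl 4 0 1 4, sl 4 4 0 4,
    sl 4 4 0 4, sl 4 0 1 4, sl 4 0 4 4, sl 0 4 1 3]

/-- Images of the arcs in `K17`: `xᵢ ↦ (1, Mᵢ)`. -/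
def img17 (i : Fin 12) : K17 := (Multiplicative.ofAdd 1, M17 i)

/-- The Wirtinger relators hold for the images. -/
theorem img17_wrel :
    ∀ t ∈ crossings237, (img17 t.1)⁻¹ * img17 t.2.1 * img17 t.1 * (img17 t.2.2)⁻¹ = 1 := by
  decide +kernel

/-- The surgery relator `μ¹⁷ λ` holds for the images. -/
theorem img17_surgery : FreeGroup.lift img17 (mu237 ^ (17 : ℕ) * lam237) = 1 := by
  simp only [mu237, lam237, map_mul, map_pow, map_zpow, FreeGroup.lift_apply_of]
  decide +kernel

/-- Every relator is killed. -/
theorem lift_img17_eq_one : ∀ r ∈ rels17, FreeGroup.lift img17 r = 1 := by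
  rintro r (rfl | hr)
  · exact img17_surgery
  · obtain ⟨t, ht, rfl⟩ := List.mem_map.mp hr
    rw [lift_wrel]
    exact img17_wrel t ht

/-- `ρ17 : G17 →* ℤ/17 × SL(2,𝔽₅)`. -/
def ρ17 : G17 →* K17 := PresentedGroup.toGroup lift_img17_eq_one

/-- `ρ17` on generators. -/
theorem ρ17_of (i : Fin 12) : ρ17 (PresentedGroup.of i) = img17 i := PresentedGroup.toGroup.of _

/-- Every element of `ℤ/17 × 1` is a power of `(10, 1) = ρ17 (x₀¹⁰)`. -/
theorem powers17 : ∀ a : Multiplicative (ZMod 17), ∃ n : Fin 17,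
    ((Multiplicative.ofAdd (10 : ZMod 17), 1) : K17) ^ (n : ℕ) = (a, 1) := by
  decide

/-- `ℤ/17 × 1 ≤ range ρ17`. -/
theorem inl_mem_range17 (a : Multiplicative (ZMod 17)) : ((a, 1) : K17) ∈ ρ17.range := by
  have h10 : ((Multiplicative.ofAdd (10 : ZMod 17), 1) : K17) ∈ ρ17.range :=
    ⟨PresentedGroup.of 0 ^ 10, by rw [map_pow, ρ17_of]; decide⟩
  obtain ⟨n, hn⟩ := powers17 a
  rw [← hn]
  exact pow_mem h10 _

/-- `(1, x) = ρ17 (x₀ x₀ x₄⁻¹ x₁⁻¹)`. -/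
theorem inr_x_mem_range17 : ((1, x) : K17) ∈ ρ17.range :=
  ⟨PresentedGroup.of 0 * PresentedGroup.of 0 * (PresentedGroup.of 4)⁻¹ * (PresentedGroup.of 1)⁻¹, by
    simp only [map_mul, map_inv, ρ17_of]; decide⟩

/-- `(1, y) = ρ17 (x₀ x₄⁻¹)`. -/
theorem inr_y_mem_range17 : ((1, y) : K17) ∈ ρ17.range :=
  ⟨PresentedGroup.of 0 * (PresentedGroup.of 4)⁻¹, by simp only [map_mul, map_inv, ρ17_of]; decide⟩

/-- SURJECTIVITY: `G17 ↠ ℤ/17 × SL(2,𝔽₅)`. -/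
theorem ρ17_surjective : Function.Surjective ρ17 := by
  rw [← MonoidHom.range_eq_top]
  exact prod_eq_top inl_mem_range17 inr_x_mem_range17 inr_y_mem_range17

/-- `|ℤ/17 × SL(2,𝔽₅)| = 2040`. -/
theorem card_K17 : Nat.card K17 = 2040 := by
  rw [Nat.card_eq_fintype_card, Fintype.card_prod, Fintype.card_multiplicative, ZMod.card, card_eq]

/-- `G17` is non-abelian: `x₀ x₄ ≠ x₄ x₀`. -/
theorem G17_noncomm : (PresentedGroup.of 0 * PresentedGroup.of 4 : G17) ≠ PresentedGroup.of 4 * PresentedGroup.of 0 := by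
  intro h
  have h' := congrArg ρ17 h
  rw [map_mul, map_mul, ρ17_of, ρ17_of] at h'
  revert h'
  decide

/-- `G17` is not cyclic (granting the presentation: `S³₁₇(P(-2,3,7))` is not a lens space). -/
theorem not_isCyclic_G17 : ¬ IsCyclic G17 := by
  intro hc
  letI : CommGroup G17 := IsCyclic.commGroup
  exact G17_noncomm (mul_comm _ _)

/-- If `G17` is finite then `|G17| ≥ 2040`. -/
theorem le_card_G17 [Finite G17] : 2040 ≤ Nat.card G17 :=
  card_K17 ▸ Nat.card_le_card_of_surjective ρ17 ρ17_surjective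

/-- With the (externally certified) upper bound `|G17| ≤ 2040`, `ρ17` is an isomorphism. -/
theorem bijective_ρ17_of_card_le [Finite G17] (h : Nat.card G17 ≤ 2040) : Function.Bijective ρ17 :=
  ρ17_surjective.bijective_of_nat_card_le (card_K17 ▸ h)

/-! ### `P(-2,3,9)`, slope `23` -/

/-- The fourteen crossings `(i, j, k)` of the standard diagram of `P(-2,3,9)` (arcs `0, …, 13`). -/
def crossings239 : List (Fin 14 × Fin 14 × Fin 14) :=
  [(0, 11, 9), (9, 12, 0), (9, 13, 8), (8, 9, 7), (7, 8, 6), (6, 7, 5), (5, 6, 4), (4, 5, 3), (3, 4, 2),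
    (2, 3, 10), (10, 2, 11), (0, 10, 1), (1, 0, 13), (13, 1, 12)]

/-- The reference meridian: arc `11`. -/
def mu239 : FreeGroup (Fin 14) := FreeGroup.of 11

/-- The preferred longitude read from arc `11` (under-passed arcs in order, writhe correction `μ⁻¹⁴`). -/
def lam239 : FreeGroup (Fin 14) :=
  FreeGroup.of 0 * FreeGroup.of 8 * FreeGroup.of 6 * FreeGroup.of 4 * FreeGroup.of 2 * FreeGroup.of 0 *
    FreeGroup.of 13 * FreeGroup.of 9 * FreeGroup.of 1 * FreeGroup.of 9 * FreeGroup.of 7 * FreeGroup.of 5 *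
    FreeGroup.of 3 * FreeGroup.of 10 * mu239 ^ (-14 : ℤ)

/-- Relators of the slope-`23` surgery group: the Wirtinger relators and `μ²³ λ`. -/
def rels23 : Set (FreeGroup (Fin 14)) := {r | r = mu239 ^ (23 : ℕ) * lam239 ∨ r ∈ crossings239.map wrel}

/-- `G23 = ⟨x₀, …, x₁₃ ∣ Wirtinger relators of P(-2,3,9), μ²³ λ⟩`. -/
abbrev G23 : Type := PresentedGroup rels23

/-- The target `ℤ/23 × SL(2,𝔽₅)`. -/
abbrev K23 : Type := Multiplicative (ZMod 23) × SL(2, ZMod 5)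

/-- Images of the arcs in `SL(2,𝔽₅)` (all of order `6`; found by exhaustive search). -/
def M23 : Fin 14 → SL(2, ZMod 5) :=
  ![sl 0 1 4 1, sl 0 4 1 1, sl 2 3 4 4, sl 2 1 2 4, sl 2 2 1 4, sl 2 4 3 4, sl 2 3 4 4, sl 2 1 2 4,
    sl 2 2 1 4, sl 2 4 3 4, sl 2 4 3 4, sl 2 2 1 4, sl 1 3 3 0, sl 2 3 4 4]

/-- Images of the arcs in `K23`: `xᵢ ↦ (1, Mᵢ)`. -/
def img23 (i : Fin 14) : K23 := (Multiplicative.ofAdd 1, M23 i)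

/-- The Wirtinger relators hold for the images. -/
theorem img23_wrel :
    ∀ t ∈ crossings239, (img23 t.1)⁻¹ * img23 t.2.1 * img23 t.1 * (img23 t.2.2)⁻¹ = 1 := by
  decide +kernel

/-- The surgery relator `μ²³ λ` holds for the images. -/
theorem img23_surgery : FreeGroup.lift img23 (mu239 ^ (23 : ℕ) * lam239) = 1 := by
  simp only [mu239, lam239, map_mul, map_pow, map_zpow, FreeGroup.lift_apply_of]
  decide +kernel

/-- Every relator is killed. -/
theorem lift_img23_eq_one : ∀ r ∈ rels23, FreeGroup.lift img23 r = 1 := by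
  rintro r (rfl | hr)
  · exact img23_surgery
  · obtain ⟨t, ht, rfl⟩ := List.mem_map.mp hr
    rw [lift_wrel]
    exact img23_wrel t ht

/-- `ρ23 : G23 →* ℤ/23 × SL(2,𝔽₅)`. -/
def ρ23 : G23 →* K23 := PresentedGroup.toGroup lift_img23_eq_one

/-- `ρ23` on generators. -/
theorem ρ23_of (i : Fin 14) : ρ23 (PresentedGroup.of i) = img23 i := PresentedGroup.toGroup.of _

/-- Every element of `ℤ/23 × 1` is a power of `(6, 1) = ρ23 (x₀⁶)`. -/
theorem powers23 : ∀ a : Multiplicative (ZMod 23), ∃ n : Fin 23,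
    ((Multiplicative.ofAdd (6 : ZMod 23), 1) : K23) ^ (n : ℕ) = (a, 1) := by
  decide

/-- `ℤ/23 × 1 ≤ range ρ23`. -/
theorem inl_mem_range23 (a : Multiplicative (ZMod 23)) : ((a, 1) : K23) ∈ ρ23.range := by
  have h6 : ((Multiplicative.ofAdd (6 : ZMod 23), 1) : K23) ∈ ρ23.range :=
    ⟨PresentedGroup.of 0 ^ 6, by rw [map_pow, ρ23_of]; decide⟩
  obtain ⟨n, hn⟩ := powers23 a
  rw [← hn]
  exact pow_mem h6 _

/-- `(1, x) = ρ23 (x₅ x₃⁻¹)`. -/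
theorem inr_x_mem_range23 : ((1, x) : K23) ∈ ρ23.range :=
  ⟨PresentedGroup.of 5 * (PresentedGroup.of 3)⁻¹, by simp only [map_mul, map_inv, ρ23_of]; decide⟩

/-- `(1, y) = ρ23 (x₀ x₁ x₃⁻¹ x₅⁻¹)`. -/
theorem inr_y_mem_range23 : ((1, y) : K23) ∈ ρ23.range :=
  ⟨PresentedGroup.of 0 * PresentedGroup.of 1 * (PresentedGroup.of 3)⁻¹ * (PresentedGroup.of 5)⁻¹, by
    simp only [map_mul, map_inv, ρ23_of]; decide⟩

/-- SURJECTIVITY: `G23 ↠ ℤ/23 × SL(2,𝔽₅)`. -/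
theorem ρ23_surjective : Function.Surjective ρ23 := by
  rw [← MonoidHom.range_eq_top]
  exact prod_eq_top inl_mem_range23 inr_x_mem_range23 inr_y_mem_range23

/-- `|ℤ/23 × SL(2,𝔽₅)| = 2760`. -/
theorem card_K23 : Nat.card K23 = 2760 := by
  rw [Nat.card_eq_fintype_card, Fintype.card_prod, Fintype.card_multiplicative, ZMod.card, card_eq]

/-- `G23` is non-abelian: `x₃ x₅ ≠ x₅ x₃`. -/
theorem G23_noncomm : (PresentedGroup.of 3 * PresentedGroup.of 5 : G23) ≠ PresentedGroup.of 5 * PresentedGroup.of 3 := by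
  intro h
  have h' := congrArg ρ23 h
  rw [map_mul, map_mul, ρ23_of, ρ23_of] at h'
  revert h'
  decide

/-- `G23` is not cyclic (granting the presentation: `S³₂₃(P(-2,3,9))` is not a lens space). -/
theorem not_isCyclic_G23 : ¬ IsCyclic G23 := by
  intro hc
  letI : CommGroup G23 := IsCyclic.commGroup
  exact G23_noncomm (mul_comm _ _)

/-- If `G23` is finite then `|G23| ≥ 2760`. -/
theorem le_card_G23 [Finite G23] : 2760 ≤ Nat.card G23 :=
  card_K23 ▸ Nat.card_le_card_of_surjective ρ23 ρ23_surjective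

/-- With the (externally certified) upper bound `|G23| ≤ 2760`, `ρ23` is an isomorphism. -/
theorem bijective_ρ23_of_card_le [Finite G23] (h : Nat.card G23 ≤ 2760) : Function.Bijective ρ23 :=
  ρ23_surjective.bijective_of_nat_card_le (card_K23 ▸ h)

end PretzelSurgery
end Summit.SmoothPoincare4.SmoothPoincare4.Theorems
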